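import Mathlib
import HarnessLib
import Literature.Analysis.FluidPDE.BiotSavartGradient
import Literature.Analysis.FluidPDE.BiotSavartBounds

/-!
# Crux `IsobarTomography.BlobRiccatiClosure` (stmt-NavierStokesRegularity-11740), line
# `type-i-apex-liouville` — the Biot–Savart velocity of a `Cⁿ` compactly supported vorticity is `Cⁿ`

Helper file (theorems only) `--supports` the item (registered stub `stub_biotSavartSmooth`). The
div–curl tomography of the velocity gradient behind the apex scale floor feeds a compactly
supported `Cⁿ` vorticity `f` to the Biot–Savart law `v = K₃ ∗ f` (`biotSavart`; Majda–Bertozzi,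
*Vorticity and Incompressible Flow* (CUP 2002), §2.4.1, (2.94)–(2.95)) and needs `v ∈ Cⁿ` (the
tree's `contDiff_biotSavart`, `contDiff_biotSavart_of_contDiff` only give `C¹`). Route, with all
derivatives falling on `f`: `biotSavart f` is Mathlib's convolution `f ⋆[apply, volume] K₃` of
`f` with the operator-valued kernel `biotSavartCLM` (`BiotSavartGradient.lean`) for the
evaluation pairing `ContinuousLinearMap.apply ℝ ℝ³ v K = K v`
(`biotSavart_eq_convolution_biotSavartCLM`); the kernel is locally integrable
(`locallyIntegrable_biotSavartCLM`: continuous off the null set `{0}`, and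
`‖K₃(z)‖ ≤ (4π)⁻¹ |z|⁻²` with `|z|⁻² ∈ L¹(B_ρ)` in `ℝ³`, the tree's `norm_biotSavartCLM_le`,
`integrable_kernelMajorant`); hence Mathlib's `HasCompactSupport.contDiff_convolution_left`
applies.
-/

noncomputable section

open MeasureTheory Set Filter Metric
open scoped Convolution Topology

-- the summit and its single sub-problem share the name (CONVENTIONS §1), as in every Theorems file
set_option linter.dupNamespace false

namespace Summit.NavierStokesRegularity.NavierStokesRegularity.Theorems.BlobRiccatiClosure.TypeIApexLiouville

open Literature.Analysis Literature.Analysis.FluidPDE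

/-- The Biot–Savart kernel `K₃ = biotSavartCLM` is a.e.-strongly measurable: it is continuous on
the open conull set `{0}ᶜ` (`contDiffAt_biotSavartCLM`). [folklore] -/
theorem aestronglyMeasurable_biotSavartCLM :
    AEStronglyMeasurable (biotSavartCLM : EuclideanSpace ℝ (Fin 3) →
      (EuclideanSpace ℝ (Fin 3) →L[ℝ] EuclideanSpace ℝ (Fin 3))) volume := by
  have hcont : ContinuousOn biotSavartCLM ({0}ᶜ : Set (EuclideanSpace ℝ (Fin 3))) :=
    fun z hz => (contDiffAt_biotSavartCLM (n := 0)
      (mem_compl_singleton_iff.1 hz)).continuousAt.continuousWithinAt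
  have h := hcont.aestronglyMeasurable (μ := volume) (measurableSet_singleton 0).compl
  rwa [restrict_compl_singleton] at h

/-- The Biot–Savart kernel is integrable on every ball about the origin:
`‖K₃(z)‖ ≤ (4π)⁻¹ |z|⁻²` (`norm_biotSavartCLM_le`) and `|z|⁻² ∈ L¹(B_ρ)` in `ℝ³`
(`integrable_kernelMajorant`, `∫_{|z|<ρ} |z|⁻² dz = 4πρ`). [folklore] -/
theorem integrableOn_biotSavartCLM_ball (ρ : ℝ) :
    IntegrableOn biotSavartCLM (ball (0 : EuclideanSpace ℝ (Fin 3)) ρ) volume := by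
  refine Integrable.mono'
    (((integrable_kernelMajorant ρ).const_mul (4 * Real.pi)⁻¹).integrableOn)
    aestronglyMeasurable_biotSavartCLM.restrict ?_
  refine (ae_restrict_iff' measurableSet_ball).2 (Eventually.of_forall fun z hz => ?_)
  rw [kernelMajorant, indicator_of_mem hz]
  exact norm_biotSavartCLM_le z

/-- **The Biot–Savart kernel is locally integrable** on `ℝ³` (every point lies in an open ball
about the origin, on which `K₃` is integrable). [folklore] -/
theorem locallyIntegrable_biotSavartCLM :
    LocallyIntegrable (biotSavartCLM : EuclideanSpace ℝ (Fin 3) →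
      (EuclideanSpace ℝ (Fin 3) →L[ℝ] EuclideanSpace ℝ (Fin 3))) volume := by
  intro x
  refine ⟨ball 0 (‖x‖ + 1), ?_, integrableOn_biotSavartCLM_ball _⟩
  exact isOpen_ball.mem_nhds (mem_ball_zero_iff.2 (lt_add_one _))

/-- **The Biot–Savart law is a convolution**: `biotSavart f = f ⋆[apply, volume] K₃`, i.e.
`(K₃ ∗ f)(x) = ∫ K₃(x − t) f(t) dt` is Mathlib's convolution of `f` with the operator-valued
kernel `biotSavartCLM` for the evaluation pairing `apply ℝ ℝ³ v K = K v` (Majda–Bertozzi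
(2.94): `v = K₃ ∗ ω`). [cite: MajdaBertozziCUP2002, §2.4.1] -/
theorem biotSavart_eq_convolution_biotSavartCLM
    (f : EuclideanSpace ℝ (Fin 3) → EuclideanSpace ℝ (Fin 3)) :
    biotSavart f =
      f ⋆[ContinuousLinearMap.apply ℝ (EuclideanSpace ℝ (Fin 3)), volume] biotSavartCLM := by
  funext x
  simp only [biotSavart, convolution_def, ContinuousLinearMap.apply_apply, biotSavartCLM_apply]

/-- **The Biot–Savart velocity of a `Cⁿ` compactly supported vorticity is `Cⁿ`** (registered
stub `stub_biotSavartSmooth`): for `f : ℝ³ → ℝ³` of class `Cⁿ` with compact support,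
`v = K₃ ∗ f = biotSavart f` is of class `Cⁿ` — all derivatives fall on `f` in the convolution
`f ⋆ K₃` with the locally integrable kernel `K₃` (Mathlib's
`HasCompactSupport.contDiff_convolution_left`; Majda–Bertozzi §2.4.1, the smooth case of
Prop. 2.16–2.17). [cite: MajdaBertozziCUP2002, §2.4.1] -/
theorem stub_biotSavartSmooth : ∀ (n : ℕ∞) (f : EuclideanSpace ℝ (Fin 3) → EuclideanSpace ℝ (Fin 3)), ContDiff ℝ n f → HasCompactSupport f → ContDiff ℝ n (biotSavart f) := by
  intro n f hf hfc
  rw [biotSavart_eq_convolution_biotSavartCLM]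
  exact hfc.contDiff_convolution_left _ hf locallyIntegrable_biotSavartCLM

end Summit.NavierStokesRegularity.NavierStokesRegularity.Theorems.BlobRiccatiClosure.TypeIApexLiouville

end
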